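import Mathlib
import HarnessLib
import Summits.HubbardSuperconductivity.HubbardSuperconductivity.Theorems.KLProgrammeKLRegimeEngineWtBudget

/-!
# K3 ENGINE child (`KLRegimeEngineV17F2`, stmt-HubbardSuperconductivity-20437): the CARVED weighted kernel profile `KernelNormsWt4` (token #8,
# plan g17 (R36) = p3 g8's cure (c2)) — `KernelNormsWt` WITHOUT the degree-`2` clause

Cell `gate-hubbard-kl`, seat p4 (g9).  At the fixed flow frame `K_n` the level-`j` two-leg kernel contains `𝒩_{K_n}` at tree level, whose first moment is
`O(n·U²)` and certified by NO slot; the degree-`2` line of the weighted profile is consumed by nobody ((E1-v4) is degrees `≥ 4`, (E1-F) degrees `≥ 6`,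
(E4)ₙ reads `.four`, the value chain inserts no `𝒲₂` vertex).  So the (b) → (c) internal currency of the engine-flow skeleton is the profile with the
degree-`2` clause CARVED OUT:

* **`KernelNormsWt4 L M N β U μ K n`** := `∀ m ≠ 2, ∀ q w, klWtPinnedSum L M β U μ K n m q w ≤ N m` (explicit `(L M)` like `KernelNormsWt`);
* `KernelNormsWt.wt4` (the full profile implies the carved one), `KernelNormsWt4.mono` (budget-monotone), `KernelNormsWt4.four` (the degree-`4` clause,
  what (E4)ₙ reads), `kernelNormsWt4_of_forall_ne_two` (intro form), `klAnisoLegKernelNorm_le_of_kernelNormsWt4` (degrees `m + 1 ≠ 2`), and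
  **`kernelNormsV4_of_kernelNormsWt4_klWtBudget`** — (E1-W)-carved at the budget `klWtBudget` implies (E1-v4) (`m = 2p`, `p ≥ 2 ⇒ m ≠ 2`).

STANDING CLAUSE (R36): if any (b)/(c) closer ever needs an `m = 2` weighted bound at `K_n` it is proved INSIDE that closer from (E3)/(R1′) data.
One definition + bookkeeping theorems; nothing about the model is asserted; nothing asserts superconductivity.
-/

noncomputable section

namespace Summit.HubbardSuperconductivity.HubbardSuperconductivity.Theorems.EngineV8

set_option linter.dupNamespace false -- summit = problem name (single-conjunct summit), D-0017

open Real Finset Literature.MathematicalPhysics.QuantumLattice Literature.Probability.LatticeModels GrassmannAlgebra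
open Summit.HubbardSuperconductivity.HubbardSuperconductivity.Theorems.KLProgrammeLegKernels
open Summit.HubbardSuperconductivity.HubbardSuperconductivity.Theorems.KLRegimeSplit

section Model

variable (L M : ℕ) [NeZero L]

/-- **`KernelNormsWt4 N … K n`** — the scale-`n` weighted kernel profile of the frame `K` in every degree `m ≠ 2`: for every pinned leg `q` and
field index `w`, `klWtPinnedSum … n m q w ≤ N m`. -/
def KernelNormsWt4 (N : ℕ → ℝ) (β U μ : ℝ) (K : TrigPolyC4v) (n : ℕ) : Prop :=
  ∀ (m : ℕ), m ≠ 2 → ∀ (q : Fin m) (w : SpaceTimeIdx L M × SectorLeg (sectorCount n)), klWtPinnedSum L M β U μ K n m q w ≤ N m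

variable {L M}

/-- The full weighted profile implies the carved one. -/
theorem KernelNormsWt.wt4 {N : ℕ → ℝ} {β U μ : ℝ} {K : TrigPolyC4v} {n : ℕ} (h : KernelNormsWt L M N β U μ K n) :
    KernelNormsWt4 L M N β U μ K n :=
  fun m _ q w => h m q w

/-- Intro form: a bound in every degree `m ≠ 2` gives `KernelNormsWt4`. -/
theorem kernelNormsWt4_of_forall_ne_two {N : ℕ → ℝ} {β U μ : ℝ} {K : TrigPolyC4v} {n : ℕ}
    (h : ∀ (m : ℕ), m ≠ 2 → ∀ (q : Fin m) (w : SpaceTimeIdx L M × SectorLeg (sectorCount n)), klWtPinnedSum L M β U μ K n m q w ≤ N m) :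
    KernelNormsWt4 L M N β U μ K n := h

/-- A larger budget is still met. -/
theorem KernelNormsWt4.mono {N N' : ℕ → ℝ} {β U μ : ℝ} {K : TrigPolyC4v} {n : ℕ} (h : KernelNormsWt4 L M N β U μ K n)
    (hNN' : ∀ m, N m ≤ N' m) : KernelNormsWt4 L M N' β U μ K n :=
  fun m hm q w => (h m hm q w).trans (hNN' m)

/-- The degree-`4` clause (`4 ≠ 2`), leg `0` pinned at the origin with label `ℓ₀` (what (E4)ₙ reads). -/
theorem KernelNormsWt4.four [NeZero M] {N : ℕ → ℝ} {β U μ : ℝ} {K : TrigPolyC4v} {n : ℕ} (h : KernelNormsWt4 L M N β U μ K n)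
    (ℓ₀ : SectorLeg (sectorCount n)) : klWtPinnedSum L M β U μ K n 4 0 ((0 : SpaceTimeIdx L M), ℓ₀) ≤ N 4 :=
  h 4 (by norm_num) 0 _

/-- **The carved profile dominates the public sectorised norm in every degree `m + 1 ≠ 2`** (port of `klAnisoLegKernelNorm_le_of_kernelNormsWt`). -/
theorem klAnisoLegKernelNorm_le_of_kernelNormsWt4 [NeZero M] {N : ℕ → ℝ} {β U μ : ℝ} (hβ : 0 ≤ β) {K : TrigPolyC4v} {n : ℕ}
    (h : KernelNormsWt4 L M N β U μ K n) (m : ℕ) (hm : m + 1 ≠ 2) : klAnisoLegKernelNorm L M β U μ K klE0 n (m + 1) ≤ N (m + 1) := by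
  have hε : 0 ≤ imagTimeWeight β M := imagTimeWeight_nonneg hβ M
  rw [klAnisoLegKernelNorm]
  refine (hubbardSectorKernelNorm_le_kernelNorm_map hβ _ _ _).trans ?_
  have hN0 : 0 ≤ N (m + 1) := (klWtPinnedSum_nonneg L M hβ U μ K n (m + 1) 0 _).trans (h (m + 1) hm 0 ((0 : SpaceTimeIdx L M),
    (((⟨0, by unfold sectorCount; positivity⟩ : Fin (sectorCount n)), (0 : Fin 2)), (0 : Fin 2))))
  refine kernelNorm_succ_le_of_forall _ m _ hN0 fun p x => ?_
  refine le_trans ?_ (h (m + 1) hm p x)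
  rw [klWtPinnedSum_def, Nat.add_sub_cancel]
  refine mul_le_mul_of_nonneg_left (sum_le_sum fun X _ => ?_) (pow_nonneg hε m)
  exact le_mul_of_one_le_left (norm_nonneg _) (one_le_klScaleWt L M β n _)

/-- **(E1-W) carved, at the budget `klWtBudget`, implies (E1-v4)** at the same frame and scale (`m = 2p`, `p ≥ 2 ⇒ m ≠ 2`):
`KernelNormsWt4 L M (klWtBudget P Q U n) β U μ K n → KernelNormsV4 L M P Q β U μ K n` (`0 ≤ β`). -/
theorem kernelNormsV4_of_kernelNormsWt4_klWtBudget [NeZero M] {P : SplitConsts} {Q : EngConsts} {β U μ : ℝ} (hβ : 0 ≤ β)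
    {K : TrigPolyC4v} {n : ℕ} (h : KernelNormsWt4 L M (klWtBudget P Q U n) β U μ K n) : KernelNormsV4 L M P Q β U μ K n := by
  intro p hp
  obtain ⟨m, hm⟩ : ∃ m, 2 * p = m + 1 := ⟨2 * p - 1, by omega⟩
  have h1 := klAnisoLegKernelNorm_le_of_kernelNormsWt4 hβ h m (by omega)
  rw [← hm] at h1
  rw [klWtBudget_two_mul_of_two_le P Q U n hp] at h1
  exact h1

end Model

end Summit.HubbardSuperconductivity.HubbardSuperconductivity.Theorems.EngineV8

end
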